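import Summits.AnomalousDissipation.AnomalousDissipation.Theorems.SolenoidalFractalHomogenisationLagrangianStepSidebandSkew
import Mathlib.Analysis.InnerProductSpace.Calculus
import Mathlib.Analysis.Calculus.Deriv.MeanValue
import HarnessLib

/-!
# K1L_D `stub_cellLawV0_IS` / `stub_D1_exactFamily` clause (i) — brick A1(a): the sideband response DECAYS off its source's slot
# (helper; `--supports stmt-AnomalousDissipation-27980 --as helper`; word-independent)

Summits-side helper file of route `SolenoidalFractalHomogenisation` (prover seat `ad-sawtooth-k1loc-p1` g12; first brick of the STRUCTURE theorem A1 of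
the sizing memo `HOME/ad-sawtooth-k1loc-p1/D1i-sizing-v2-k1locp1g12.md` for the exact family `Sideband.psiStar` of D26-3).  Between two times of one period
on which the envelope of slot `j` vanishes, the source of slot `j` is `0` (`source_eq_zero_of_slotEnvelope`) and any periodic response `N` of slot `j`
(`Sideband.IsPeriodicResponse`) evolves by the dissipative generator alone, so by the energy identity and w1's dissipativity `real_inner_gen_le`
(`⟪gen y, y⟫ ≤ −r‖y‖²`, `r = min γ₁ (4π²lo')`): **`‖N t₁ v‖ ≤ e^{−r(t₁−t₀)} ‖N t₀ v‖`** (`norm_response_le_exp_of_envelope_zero`).  This is the `e^{−T_min b}`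
suppression of every memory path except the colinear adjacent pair.  Everything PROVED, no definition, no named fact, no sorry.  NOT a proof of the stub;
rung leaf F-D1.A0.
-/

set_option linter.dupNamespace false

noncomputable section

namespace Summit.AnomalousDissipation.AnomalousDissipation.Theorems.SolenoidalFractalHomogenisation.LagrangianStep.Sideband

open Set MeasureTheory Complex
open scoped InnerProductSpace
open Literature.Analysis Literature.Analysis.FunctionSpaces Literature.Analysis.FunctionSpaces.Torus
open Literature.Analysis.FluidPDE Literature.Analysis.FluidPDE.Torus Literature.Analysis.FluidPDE.LatticeShear

variable {k₀ : ℕ}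

/-- The source of slot `j` vanishes where its envelope does. [cite: MajdaKramer1999, §2.2.1.3] -/
theorem source_eq_zero_of_slotEnvelope (W₁ : LatticeWord k₀) (R : ℕ) (j : Fin k₀) {t : ℝ} (ht : slotEnvelope W₁ j t = 0) :
    source W₁ R j t = 0 := by
  ext v z i
  rw [source_apply]
  simp only [sourceComp, ht, Complex.ofReal_zero, mul_zero, zero_mul, neg_zero]
  split_ifs <;> simp

/-- **Off-slot decay of a periodic response.**  If `N` is a periodic response of slot `j` (`NearIso 𝔸 lo' hi'`, `lo' ≥ 0`) and the envelope of slot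
`j` vanishes on `[t₀, t₁] ⊆ [0, P)`, then `‖N t₁ v‖ ≤ e^{−r(t₁−t₀)}‖N t₀ v‖` with `r = min γ₁ (4π²lo')`. [cite: SandersVerhulstMurdock2007, Lemma 5.2.7 (linear case)] -/
theorem norm_response_le_exp_of_envelope_zero (W₁ : LatticeWord k₀) {𝔸 : Torus.Visc4 (Fin 3)} {lo' hi' : ℝ}
    (h𝔸 : Torus.NearIso 𝔸 lo' hi') (hlo' : 0 ≤ lo') (γ₁ : ℝ) (R : ℕ) (j : Fin k₀)
    {N : ℝ → (EuclideanSpace ℂ (Fin 3) →L[ℝ] Space R)} (hN : IsPeriodicResponse W₁ 𝔸 γ₁ R j N)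
    (v : EuclideanSpace ℂ (Fin 3)) {t₀ t₁ : ℝ} (h0 : 0 ≤ t₀) (h01 : t₀ ≤ t₁) (h1 : t₁ < W₁.period)
    (henv : ∀ t ∈ Icc t₀ t₁, slotEnvelope W₁ j t = 0) :
    ‖N t₁ v‖ ≤ Real.exp (-(min γ₁ (4 * Real.pi ^ 2 * lo') * (t₁ - t₀))) * ‖N t₀ v‖ := by
  set r := min γ₁ (4 * Real.pi ^ 2 * lo') with hr
  set u : ℝ → Space R := fun t => N t v with hu
  -- the orbit solves `u' = gen u` on `[t₀, t₁]`
  have hderiv : ∀ t ∈ Icc t₀ t₁, HasDerivAt u (((gen W₁ 𝔸 γ₁ R t).restrictScalars ℝ) (u t)) t := by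
    intro t ht
    have htP : t ∈ Ico 0 W₁.period := ⟨h0.trans ht.1, lt_of_le_of_lt ht.2 h1⟩
    have h := (hN.2.1 t htP).clm_apply (hasDerivAt_const t v)
    rw [source_eq_zero_of_slotEnvelope W₁ R j (henv t ht)] at h
    simpa [hu] using h
  -- energy `ψ = e^{2rt}‖u‖²` is non-increasing
  set ψ : ℝ → ℝ := fun t => Real.exp (2 * r * t) * ‖u t‖ ^ 2 with hψ
  have hψd : ∀ t ∈ Icc t₀ t₁, HasDerivAt ψ (Real.exp (2 * r * t) * (2 * r) * ‖u t‖ ^ 2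
      + Real.exp (2 * r * t) * (2 * ⟪u t, ((gen W₁ 𝔸 γ₁ R t).restrictScalars ℝ) (u t)⟫_ℝ)) t := by
    intro t ht
    have h1 : HasDerivAt (fun s => Real.exp (2 * r * s)) (Real.exp (2 * r * t) * (2 * r)) t := by
      simpa using ((hasDerivAt_id t).const_mul (2 * r)).exp
    have h2 : HasDerivAt (fun s => ‖u s‖ ^ 2) (2 * ⟪u t, ((gen W₁ 𝔸 γ₁ R t).restrictScalars ℝ) (u t)⟫_ℝ) t := by
      have h := (hderiv t ht).norm_sq
      simpa using h
    exact h1.mul h2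
  have hψle : ∀ t ∈ Icc t₀ t₁, Real.exp (2 * r * t) * (2 * r) * ‖u t‖ ^ 2
      + Real.exp (2 * r * t) * (2 * ⟪u t, ((gen W₁ 𝔸 γ₁ R t).restrictScalars ℝ) (u t)⟫_ℝ) ≤ 0 := by
    intro t _
    have hg := real_inner_gen_le W₁ h𝔸 hlo' γ₁ R t (u t)
    rw [real_inner_comm] at hg
    have he : 0 < Real.exp (2 * r * t) := Real.exp_pos _
    have : ⟪u t, ((gen W₁ 𝔸 γ₁ R t).restrictScalars ℝ) (u t)⟫_ℝ ≤ -r * ‖u t‖ ^ 2 := by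
      simpa [hr] using hg
    nlinarith
  have hanti : AntitoneOn ψ (Icc t₀ t₁) := by
    refine antitoneOn_of_deriv_nonpos (convex_Icc t₀ t₁) ?_ ?_ ?_
    · exact fun t ht => (hψd t ht).continuousAt.continuousWithinAt
    · intro t ht
      rw [interior_Icc] at ht
      exact (hψd t ⟨ht.1.le, ht.2.le⟩).differentiableAt.differentiableWithinAt
    · intro t ht
      rw [interior_Icc] at ht
      rw [(hψd t ⟨ht.1.le, ht.2.le⟩).deriv]
      exact hψle t ⟨ht.1.le, ht.2.le⟩
  have hmono := hanti (left_mem_Icc.2 h01) (right_mem_Icc.2 h01) h01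
  -- unwind
  simp only [hψ] at hmono
  have he0 : 0 < Real.exp (2 * r * t₁) := Real.exp_pos _
  have hsq : ‖u t₁‖ ^ 2 ≤ (Real.exp (-(r * (t₁ - t₀))) * ‖u t₀‖) ^ 2 := by
    rw [mul_pow, ← Real.exp_nat_mul]
    have hexp : Real.exp (↑(2:ℕ) * -(r * (t₁ - t₀))) * Real.exp (2 * r * t₁) = Real.exp (2 * r * t₀) := by
      rw [← Real.exp_add]; congr 1; push_cast; ring
    have := mul_le_mul_of_nonneg_left hmono (Real.exp_pos (↑(2:ℕ) * -(r * (t₁ - t₀)))).le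
    rw [← mul_assoc, ← mul_assoc, hexp] at this
    have he1 : 0 < Real.exp (2 * r * t₀) := Real.exp_pos _
    nlinarith [this]
  have hnn : 0 ≤ Real.exp (-(r * (t₁ - t₀))) * ‖u t₀‖ := by positivity
  exact (abs_le_of_sq_le_sq' hsq hnn).2.trans (le_of_eq (by simp [hu]))

end Summit.AnomalousDissipation.AnomalousDissipation.Theorems.SolenoidalFractalHomogenisation.LagrangianStep.Sideband
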